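import Literature.AlgebraicGeometry.HodgeTheory.FermatAokiSubvarietyStabilizer
import HarnessLib

/-!
# `p = 3`: the cubic section `X²_{3d} ∩ V₊(x₃³ - c'x₀x₁x₂)` is Aoki's curve `Y_{c'}` plus its two "twisted" translates

Family `hodge`, layer `Literature/AlgebraicGeometry/HodgeTheory`. PROOF FILE (theorems only; sequel of
`FermatAokiSubvarietyStabilizer`) for the leaf `Aoki1987_thm_2_1_supportedClass` of
`Aoki1987_claim_pStandard`, case `r = 1` (`p = 3`, the CURVE `Y : x₀ᵈ + x₁ᵈ + x₂ᵈ = 0, x₃³ = c x₀x₁x₂` on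
the Fermat surface `X²_{3d}`, Aoki 1987 (2.1) and Thm. 2-1 p. 388). On `X²_{3d}` with `m = 3d` and
`c'ᵈ = -3`:

  `x₀ᵐ + x₁ᵐ + x₂ᵐ + x₃ᵐ ≡ y₀³ + y₁³ + y₂³ - 3y₀y₁y₂ = (y₀ + y₁ + y₂)(y₀ + ωy₁ + ω²y₂)(y₀ + ω²y₁ + ωy₂)`
  modulo `x₃³ - c' x₀x₁x₂` (`yᵢ = xᵢᵈ`, `ω` a primitive cube root of unity),

so the cubic section `X ∩ V₊(x₃³ - c'x₀x₁x₂)` is the union of the three curves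
`{y₀ + ωʲy₁ + ω²ʲy₂ = 0, x₃³ = c'x₀x₁x₂}`, `j = 0, 1, 2` — `Y_{c'}` and its preimages under the diagonal
symmetries `g_b`, `g_{b²}`, `b = (1, ξ, ξ², ξ)` with `ξᵈ = ω`
(`Aoki1987.preimage_zeroLocus_f0_eq_union_three`). With `FermatAokiSectionDecomposition` (the degree-`d`
sections `V₊(e₁(xᵈ)) ∩ X = ⋃ Y_{cζ}`) this is the second family of relations ("`3H ∼ Y + Y' + Y''`") of the
restriction method for Thm. 2-1 at `p = 3`: restricted to `Y` it identifies the classes of the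
same-section translates `Y_{cζ}`, `ζ ≠ 1`.

* `Aoki1987.sum_cube_sub_three_mul_eq_prod` — the factorisation of `a³ + b³ + c³ - 3abc`;
* `Aoki1987.aeval_diagonalSubst_sum_pow`, `Aoki1987.aeval_diagonalSubst_f0_smul` — the substituted
  equations (`σ_b(Σ xᵢᵈ) = Σ bᵢᵈ xᵢᵈ`, `σ_b f₀(c') = b₃³ f₀(c')` when `b₀b₁b₂ = b₃³`);
* **`Aoki1987.preimage_zeroLocus_f0_eq_union_three`**.

## References

* [Aoki1987] N. Aoki, Some new algebraic cycles on Fermat varieties, J. Math. Soc. Japan 39 (1987)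
  385–396: (2.1) and Thm. 2-1 (p. 388), §3 (pp. 389–390), §4.
-/

noncomputable section

open CategoryTheory AlgebraicGeometry MvPolynomial Finset

namespace Literature.AlgebraicGeometry.HodgeTheory

open Literature.AlgebraicGeometry.Motives

namespace Aoki1987

/-! ### Algebra -/

/-- **`a³ + b³ + c³ - 3abc = (a + b + c)(a + ωb + ω²c)(a + ω²b + ωc)`** for `ω³ = 1`, `1 + ω + ω² = 0`
(coefficients `C ω` in a polynomial ring over `ℂ`). [folklore] -/
theorem sum_cube_sub_three_mul_eq_prod {σ : Type*} {ω : ℂ} (hω3 : ω ^ 3 = 1) (hωs : 1 + ω + ω ^ 2 = 0)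
    (a b c : MvPolynomial σ ℂ) :
    a ^ 3 + b ^ 3 + c ^ 3 - 3 * a * b * c =
      (a + b + c) * (a + C ω * b + C (ω ^ 2) * c) * (a + C (ω ^ 2) * b + C ω * c) := by
  have h3 : (C ω : MvPolynomial σ ℂ) ^ 3 = 1 := by rw [← map_pow, hω3, map_one]
  have hs : (1 : MvPolynomial σ ℂ) + C ω + C ω ^ 2 = 0 := by
    rw [← map_pow, ← map_one C, ← map_add, ← map_add, hωs, map_zero]
  rw [map_pow]
  linear_combination (-(b ^ 3 + c ^ 3 + a * b ^ 2 + a * c ^ 2 + C ω * a * b * c)) * h3 +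
    (-(a ^ 2 * b + a ^ 2 * c + a * b ^ 2 + a * c ^ 2 + C ω ^ 2 * b ^ 2 * c + C ω ^ 2 * b * c ^ 2 +
      3 * a * b * c)) * hs

/-- `e₁(x₀ᵈ, x₁ᵈ, x₂ᵈ) = x₀ᵈ + x₁ᵈ + x₂ᵈ` in `ℂ[x₀, x₁, x₂, x₃]` (the equation `f₁` of Aoki's curve for
`p = 3`). [cite: Aoki1987, (2.1) (p. 388)] -/
theorem aeval_esymm_one_eq (d : ℕ) :
    aeval (fun i : Fin (2 * 1 + 1) ↦ (X (Fin.castSucc i) : MvPolynomial (Fin (2 * 1 + 2)) ℂ) ^ d)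
        (esymm (Fin (2 * 1 + 1)) ℂ 1) =
      X 0 ^ d + X 1 ^ d + X 2 ^ d := by
  rw [MvPolynomial.esymm_one, map_sum]
  simp only [aeval_X]
  rw [Fin.sum_univ_three]
  rfl

/-- `σ_b(x₀ᵈ + x₁ᵈ + x₂ᵈ) = b₀ᵈ x₀ᵈ + b₁ᵈ x₁ᵈ + b₂ᵈ x₂ᵈ`. [folklore] -/
theorem aeval_diagonalSubst_sum_pow (b : Fin (2 * 1 + 2) → ℂˣ) (d : ℕ) :
    aeval (diagonalSubst b) ((X 0 : MvPolynomial (Fin (2 * 1 + 2)) ℂ) ^ d + X 1 ^ d + X 2 ^ d) =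
      C (((b 0 : ℂˣ) : ℂ) ^ d) * X 0 ^ d + C (((b 1 : ℂˣ) : ℂ) ^ d) * X 1 ^ d + C (((b 2 : ℂˣ) : ℂ) ^ d) * X 2 ^ d := by
  simp only [map_add, map_pow, aeval_X, diagonalSubst_apply, mul_pow, map_pow]

/-- `σ_b f₀(c') = b₃³ · f₀(c')` when `b₀b₁b₂ = b₃³`. [cite: Aoki1987, proof of Prop. 3-1 (ii) (p. 390)] -/
theorem aeval_diagonalSubst_f0_smul (b : Fin (2 * 1 + 2) → ℂˣ)
    (hb : ((b 0 : ℂˣ) : ℂ) * (b 1 : ℂ) * (b 2 : ℂ) = ((b 3 : ℂˣ) : ℂ) ^ 3) (c' : ℂ) :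
    aeval (diagonalSubst b)
        ((X (Fin.last (2 * 1 + 1)) : MvPolynomial (Fin (2 * 1 + 2)) ℂ) ^ (2 * 1 + 1) -
          C c' * ∏ i : Fin (2 * 1 + 1), X (Fin.castSucc i)) =
      C (((b 3 : ℂˣ) : ℂ) ^ 3) *
        ((X (Fin.last (2 * 1 + 1)) : MvPolynomial (Fin (2 * 1 + 2)) ℂ) ^ (2 * 1 + 1) -
          C c' * ∏ i : Fin (2 * 1 + 1), X (Fin.castSucc i)) := by
  rw [map_sub, map_mul, map_pow, map_prod, aeval_C, algebraMap_eq]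
  simp_rw [aeval_X, diagonalSubst_apply]
  rw [Fin.prod_univ_three, Fin.prod_univ_three]
  change (C ((b 3 : ℂˣ) : ℂ) * X 3) ^ (2 * 1 + 1) - C c' * (C ((b 0 : ℂˣ) : ℂ) * X 0 * (C ((b 1 : ℂˣ) : ℂ) * X 1) *
      (C ((b 2 : ℂˣ) : ℂ) * X 2)) =
    C (((b 3 : ℂˣ) : ℂ) ^ 3) * ((X 3 : MvPolynomial (Fin (2 * 1 + 2)) ℂ) ^ (2 * 1 + 1) - C c' * (X 0 * X 1 * X 2))
  have h : (C ((b 0 : ℂˣ) : ℂ) : MvPolynomial (Fin (2 * 1 + 2)) ℂ) * C ((b 1 : ℂˣ) : ℂ) * C ((b 2 : ℂˣ) : ℂ) =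
      C ((b 3 : ℂˣ) : ℂ) ^ 3 := by
    rw [← map_mul, ← map_mul, hb, map_pow]
  rw [map_pow]
  linear_combination (-(C c' * X 0 * X 1 * X 2)) * h

/-! ### The cubic section of the Fermat surface `X²_{3d}` -/

variable {m d : ℕ}

/-- **`X²_{3d} ∩ V₊(x₃³ - c' x₀x₁x₂) = Y_{c'} ∪ g_b⁻¹(Y_{c'}) ∪ g_{b²}⁻¹(Y_{c'})`** for `c'ᵈ = -3`,
`b = (1, ξ, ξ², ξ)` with `ω = ξᵈ` a primitive cube root of unity (`b ∈ μₘ⁴`, `m = 3d`): modulo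
`x₃³ - c'x₀x₁x₂` the Fermat form is `y₀³ + y₁³ + y₂³ - 3y₀y₁y₂ = ∏ⱼ (y₀ + ωʲy₁ + ω²ʲy₂)`
(`yᵢ = xᵢᵈ`), a homogeneous prime containing it contains one factor, and
`y₀ + ωʲ y₁ + ω²ʲ y₂ = σ_{bʲ}(y₀ + y₁ + y₂)`, `σ_{bʲ} f₀(c') = ξ³ʲ f₀(c')` are the equations of
`g_{bʲ}⁻¹(Y_{c'})`. In print: the three curves over the lines of `y₀³ + y₁³ + y₂³ = 3y₀y₁y₂`.
[cite: Aoki1987, (2.1) (p. 388) and §3 (pp. 389–390)] -/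
theorem preimage_zeroLocus_f0_eq_union_three (hd : 0 < d) (hm : m = 3 * d) {c' ξ : ℂ}
    (hc' : c' ^ d = -(3 : ℂ)) (hξ : IsPrimitiveRoot (ξ ^ d) 3) (b : Fin (2 * 1 + 2) → ℂˣ)
    (hb0 : ((b 0 : ℂˣ) : ℂ) = 1) (hb1 : ((b 1 : ℂˣ) : ℂ) = ξ) (hb2 : ((b 2 : ℂˣ) : ℂ) = ξ ^ 2)
    (hb3 : ((b 3 : ℂˣ) : ℂ) = ξ)
    (hb : b ∈ diagonalStabilizer (fermatPolynomial ℂ (2 * 1) m))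
    (hbb : b * b ∈ diagonalStabilizer (fermatPolynomial ℂ (2 * 1) m)) :
    letI := MvPolynomial.gradedAlgebra (σ := Fin (2 * 1 + 2)) (R := ℂ)
    (SmoothHypersurface.hypersurfaceι (fermatPolynomial ℂ (2 * 1) m)).left.base ⁻¹'
        ProjectiveSpectrum.zeroLocus (MvPolynomial.homogeneousSubmodule (Fin (2 * 1 + 2)) ℂ)
          {(X (Fin.last (2 * 1 + 1)) : MvPolynomial (Fin (2 * 1 + 2)) ℂ) ^ (2 * 1 + 1) -
            C c' * ∏ i : Fin (2 * 1 + 1), X (Fin.castSucc i)} =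
      fermatAokiSection m 1 d c' ∪
        (diagonalAut (fermatPolynomial ℂ (2 * 1) m) hb).left.base ⁻¹' fermatAokiSection m 1 d c' ∪
        (diagonalAut (fermatPolynomial ℂ (2 * 1) m) hbb).left.base ⁻¹' fermatAokiSection m 1 d c' := by
  letI := MvPolynomial.gradedAlgebra (σ := Fin (2 * 1 + 2)) (R := ℂ)
  let 𝒜 := MvPolynomial.homogeneousSubmodule (Fin (2 * 1 + 2)) ℂ
  set ω : ℂ := ξ ^ d with hωdef
  have hω3 : ω ^ 3 = 1 := hξ.pow_eq_one
  have hωs : 1 + ω + ω ^ 2 = 0 := by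
    have h := hξ.geom_sum_eq_zero (by norm_num : 1 < 3)
    simpa [Finset.sum_range_succ, add_assoc] using h
  have hξ0 : ξ ≠ 0 := by
    rintro rfl
    rw [zero_pow hd.ne'] at hωdef
    rw [hωdef] at hω3
    norm_num at hω3
  -- notation for the equations
  set f0 : MvPolynomial (Fin (2 * 1 + 2)) ℂ :=
    X (Fin.last (2 * 1 + 1)) ^ (2 * 1 + 1) - C c' * ∏ i : Fin (2 * 1 + 1), X (Fin.castSucc i) with hf0
  set L0 : MvPolynomial (Fin (2 * 1 + 2)) ℂ := X 0 ^ d + X 1 ^ d + X 2 ^ d with hL0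
  set L1 : MvPolynomial (Fin (2 * 1 + 2)) ℂ := X 0 ^ d + C ω * X 1 ^ d + C (ω ^ 2) * X 2 ^ d with hL1
  set L2 : MvPolynomial (Fin (2 * 1 + 2)) ℂ := X 0 ^ d + C (ω ^ 2) * X 1 ^ d + C ω * X 2 ^ d with hL2
  -- the substituted equations
  have hprodb : ((b 0 : ℂˣ) : ℂ) * (b 1 : ℂ) * (b 2 : ℂ) = ((b 3 : ℂˣ) : ℂ) ^ 3 := by
    rw [hb0, hb1, hb2, hb3]; ring
  have hprodbb : (((b * b) 0 : ℂˣ) : ℂ) * ((b * b) 1 : ℂ) * ((b * b) 2 : ℂ) = (((b * b) 3 : ℂˣ) : ℂ) ^ 3 := by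
    simp only [Pi.mul_apply, Units.val_mul, hb0, hb1, hb2, hb3]; ring
  have hσe1 : aeval (diagonalSubst b) (aeval (fun i : Fin (2 * 1 + 1) ↦
      (X (Fin.castSucc i) : MvPolynomial (Fin (2 * 1 + 2)) ℂ) ^ d) (esymm (Fin (2 * 1 + 1)) ℂ 1)) = L1 := by
    rw [aeval_esymm_one_eq, aeval_diagonalSubst_sum_pow, hb0, hb1, hb2, one_pow, map_one, one_mul, hL1,
      ← pow_mul, mul_comm 2 d, pow_mul]
  have hσe2 : aeval (diagonalSubst (b * b)) (aeval (fun i : Fin (2 * 1 + 1) ↦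
      (X (Fin.castSucc i) : MvPolynomial (Fin (2 * 1 + 2)) ℂ) ^ d) (esymm (Fin (2 * 1 + 1)) ℂ 1)) = L2 := by
    rw [aeval_esymm_one_eq, aeval_diagonalSubst_sum_pow]
    simp only [Pi.mul_apply, Units.val_mul, hb0, hb1, hb2, mul_one, one_pow, map_one, one_mul]
    rw [hL2]
    have h4 : (ξ ^ 2 * ξ ^ 2) ^ d = ω := by
      rw [← pow_add, ← pow_mul, show (2 + 2) * d = d * 3 + d by ring, pow_add, pow_mul, ← hωdef, hω3, one_mul]
    have h2 : (ξ * ξ) ^ d = ω ^ 2 := by rw [← sq, ← pow_mul, mul_comm 2 d, pow_mul]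
    rw [h2, h4]
  have hσf0 : aeval (diagonalSubst b) f0 = C (((b 3 : ℂˣ) : ℂ) ^ 3) * f0 := aeval_diagonalSubst_f0_smul b hprodb c'
  have hσf0' : aeval (diagonalSubst (b * b)) f0 = C ((((b * b) 3 : ℂˣ) : ℂ) ^ 3) * f0 :=
    aeval_diagonalSubst_f0_smul (b * b) hprodbb c'
  have hu : (((b 3 : ℂˣ) : ℂ) ^ 3) ≠ 0 := pow_ne_zero _ (b 3).ne_zero
  have hu' : ((((b * b) 3 : ℂˣ) : ℂ) ^ 3) ≠ 0 := pow_ne_zero _ ((b * b) 3).ne_zero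
  -- points, primes
  have hcomp : ∀ {a : Fin (2 * 1 + 2) → ℂˣ} (ha : a ∈ diagonalStabilizer (fermatPolynomial ℂ (2 * 1) m))
      (z : ↥(fermatHypersurface (2 * 1) m).left),
      (SmoothHypersurface.hypersurfaceι (fermatPolynomial ℂ (2 * 1) m)).left.base
          ((diagonalAut (fermatPolynomial ℂ (2 * 1) m) ha).left.base z) =
        (diagonalProjMap a).left.base
          ((SmoothHypersurface.hypersurfaceι (fermatPolynomial ℂ (2 * 1) m)).left.base z) := by
    intro a ha z
    have h := congrArg (fun f ↦ f.base z) (diagonalAut_left_comp_ι (fermatPolynomial ℂ (2 * 1) m) ha)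
    simpa using h
  -- membership in a translate in terms of the prime of `ι z`
  have htrans : ∀ {a : Fin (2 * 1 + 2) → ℂˣ} (ha : a ∈ diagonalStabilizer (fermatPolynomial ℂ (2 * 1) m))
      (z : ↥(fermatHypersurface (2 * 1) m).left),
      z ∈ (diagonalAut (fermatPolynomial ℂ (2 * 1) m) ha).left.base ⁻¹' fermatAokiSection m 1 d c' ↔
        aeval (diagonalSubst a) '' aokiEquations 1 d c' ⊆
          (((SmoothHypersurface.hypersurfaceι (fermatPolynomial ℂ (2 * 1) m)).left.base z :
            ProjectiveSpectrum 𝒜).asHomogeneousIdeal : Set _) := by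
    intro a ha z
    rw [Set.mem_preimage]
    change (SmoothHypersurface.hypersurfaceι (fermatPolynomial ℂ (2 * 1) m)).left.base
        ((diagonalAut (fermatPolynomial ℂ (2 * 1) m) ha).left.base z) ∈ aokiSubvariety 1 d c' ↔ _
    rw [hcomp ha z, ← Set.mem_preimage, aokiSubvariety, diagonalProjMap_preimage_zeroLocus]
    exact ProjectiveSpectrum.mem_zeroLocus _ _ _
  ext z
  set w : ↥(projectiveSpace (2 * 1 + 1) ℂ).left :=
    (SmoothHypersurface.hypersurfaceι (fermatPolynomial ℂ (2 * 1) m)).left.base z with hw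
  let P : Ideal (MvPolynomial (Fin (2 * 1 + 2)) ℂ) := ((w : ProjectiveSpectrum 𝒜).asHomogeneousIdeal).toIdeal
  haveI hPprime : P.IsPrime := (w : ProjectiveSpectrum 𝒜).isPrime
  have hmemP : ∀ s, s ∈ ((w : ProjectiveSpectrum 𝒜).asHomogeneousIdeal : Set _) ↔ s ∈ P := fun s ↦ Iff.rfl
  simp only [Set.mem_preimage, Set.mem_union]
  rw [show z ∈ fermatAokiSection m 1 d c' ↔ aokiEquations 1 d c' ⊆ (P : Set _) from
    ProjectiveSpectrum.mem_zeroLocus _ _ _]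
  have ht1 := htrans hb z
  have ht2 := htrans hbb z
  rw [Set.mem_preimage] at ht1 ht2
  rw [ht1, ht2]
  constructor
  · -- `⊆`: a prime containing `F` and `f₀` contains one of the `L_j`
    intro hz
    have hf0P : f0 ∈ P := (ProjectiveSpectrum.mem_zeroLocus _ _ _).mp hz (Set.mem_singleton _)
    have hF : fermatPolynomial ℂ (2 * 1) m ∈ P := by
      have hwF : w ∈ ProjectiveSpectrum.zeroLocus 𝒜 {fermatPolynomial ℂ (2 * 1) m} :=
        (Set.ext_iff.mp (SmoothHypersurface.range_hypersurfaceι (fermatPolynomial ℂ (2 * 1) m)) w).mp ⟨z, rfl⟩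
      exact (ProjectiveSpectrum.mem_zeroLocus _ _ _).mp hwF (Set.mem_singleton _)
    -- `x₃^{3d} - (c' x₀x₁x₂)ᵈ ∈ (f₀)`
    have hdiff : (X (Fin.last (2 * 1 + 1)) : MvPolynomial (Fin (2 * 1 + 2)) ℂ) ^ (3 * d) -
        (C c' * ∏ i : Fin (2 * 1 + 1), X (Fin.castSucc i)) ^ d ∈ P := by
      obtain ⟨q, hq⟩ := sub_dvd_pow_sub_pow ((X (Fin.last (2 * 1 + 1)) : MvPolynomial (Fin (2 * 1 + 2)) ℂ) ^ (2 * 1 + 1))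
        (C c' * ∏ i : Fin (2 * 1 + 1), X (Fin.castSucc i)) d
      rw [← pow_mul, show (2 * 1 + 1) * d = 3 * d by ring] at hq
      rw [hq]
      exact Ideal.mul_mem_right _ _ hf0P
    -- hence `L0 L1 L2 ∈ P`
    have hG : L0 * L1 * L2 ∈ P := by
      have h := Ideal.sub_mem P hF hdiff
      have heq : fermatPolynomial ℂ (2 * 1) m - ((X (Fin.last (2 * 1 + 1)) : MvPolynomial (Fin (2 * 1 + 2)) ℂ) ^ (3 * d) -
          (C c' * ∏ i : Fin (2 * 1 + 1), X (Fin.castSucc i)) ^ d) = L0 * L1 * L2 := by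
        have hX0 : (Fin.castSucc (0 : Fin (2 * 1 + 1)) : Fin (2 * 1 + 2)) = 0 := rfl
        have hX1 : (Fin.castSucc (1 : Fin (2 * 1 + 1)) : Fin (2 * 1 + 2)) = 1 := rfl
        have hX2 : (Fin.castSucc (2 : Fin (2 * 1 + 1)) : Fin (2 * 1 + 2)) = 2 := rfl
        have hX3 : (Fin.last (2 * 1 + 1) : Fin (2 * 1 + 2)) = 3 := rfl
        rw [hL0, hL1, hL2, ← sum_cube_sub_three_mul_eq_prod hω3 hωs, hm]
        change (∑ i : Fin (2 * 1 + 2), (X i : MvPolynomial (Fin (2 * 1 + 2)) ℂ) ^ (3 * d)) - _ = _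
        rw [Fin.sum_univ_four, Fin.prod_univ_three, mul_pow, ← map_pow, hc', map_neg,
          show (C 3 : MvPolynomial (Fin (2 * 1 + 2)) ℂ) = 3 from map_ofNat C 3, hX0, hX1, hX2, hX3]
        simp only [pow_mul']
        ring
      rwa [heq] at h
    rcases hPprime.mem_or_mem hG with h01 | h2
    · rcases hPprime.mem_or_mem h01 with h0 | h1
      · -- `L0 ∈ P`: the point lies on `Y_{c'}`
        refine Or.inl (Or.inl fun s hs ↦ ?_)
        rcases Set.mem_insert_iff.mp hs with rfl | ⟨j, hj, rfl⟩
        · exact hf0P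
        · have hj1 : j = 1 := le_antisymm hj.2 hj.1
          subst hj1
          beta_reduce
          rw [SetLike.mem_coe, aeval_esymm_one_eq d, ← hL0]
          exact h0
      · -- `L1 ∈ P`: the point lies on `g_b⁻¹ Y_{c'}`
        refine Or.inl (Or.inr ?_)
        rintro _ ⟨s, hs, rfl⟩
        rcases Set.mem_insert_iff.mp hs with rfl | ⟨j, hj, rfl⟩
        · rw [hmemP, show aeval (diagonalSubst b) _ = _ from hσf0]
          exact Ideal.mul_mem_left _ _ hf0P
        · have hj1 : j = 1 := le_antisymm hj.2 hj.1
          subst hj1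
          rw [hmemP, hσe1]
          exact h1
    · -- `L2 ∈ P`: the point lies on `g_{b²}⁻¹ Y_{c'}`
      refine Or.inr ?_
      rintro _ ⟨s, hs, rfl⟩
      rcases Set.mem_insert_iff.mp hs with rfl | ⟨j, hj, rfl⟩
      · rw [hmemP, show aeval (diagonalSubst (b * b)) _ = _ from hσf0']
        exact Ideal.mul_mem_left _ _ hf0P
      · have hj1 : j = 1 := le_antisymm hj.2 hj.1
        subst hj1
        rw [hmemP, hσe2]
        exact h2
  · -- `⊇`: each piece lies in `V₊(f₀)`
    intro hz
    refine (ProjectiveSpectrum.mem_zeroLocus _ _ _).mpr (Set.singleton_subset_iff.mpr ?_)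
    rw [hmemP]
    rcases hz with (h | h) | h
    · exact h (f0_mem_aokiEquations 1 d c')
    · have h1 : aeval (diagonalSubst b) f0 ∈ P := h ⟨f0, f0_mem_aokiEquations 1 d c', rfl⟩
      rw [hσf0] at h1
      have h2 := Ideal.mul_mem_left _ (C ((((b 3 : ℂˣ) : ℂ) ^ 3))⁻¹) h1
      rwa [← mul_assoc, ← map_mul, inv_mul_cancel₀ hu, map_one, one_mul] at h2
    · have h1 : aeval (diagonalSubst (b * b)) f0 ∈ P := h ⟨f0, f0_mem_aokiEquations 1 d c', rfl⟩
      rw [hσf0'] at h1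
      have h2 := Ideal.mul_mem_left _ (C (((((b * b) 3 : ℂˣ) : ℂ) ^ 3))⁻¹) h1
      rwa [← mul_assoc, ← map_mul, inv_mul_cancel₀ hu', map_one, one_mul] at h2

end Aoki1987

end Literature.AlgebraicGeometry.HodgeTheory

end
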